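import Summits.QuantumFields.YangMills.Theorems.UnitScaleTiltProp7ComplementaryProjectorPointwiseDecayClosed
import HarnessLib

/-!
# Route `UnitScaleTilt`, crux K1 «MinimiserStabilityRegPr» (stmt-QuantumFields-19200), EX row `norm_G`, N6 FILE D letters (cκ) — **(W2) P-κ: THE ONE-BLOCK SUP LETTER OF
# PRINT'S COMPLEMENTARY GAUGE PROJECTOR `P = 1 − R_{Q″}(U₀)`** — for `g` supported in the block `B(v)` with `‖g(x)‖ ≤ G_b`: `‖(Pg)(x₀)‖ ≤ C_P·(L^d)^{K−n}·G_b·e^{−μ′·tdist(B x₀, v)}`,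
# from a displayed SPIKE KERNEL letter (§1, any linear `P`) inhabited BY NAME by px5 g12's V5b ✓`Prop7ComplementaryProjectorPointwiseDecayClosed.norm_equiv_sub_projR_single_le_closed`
# (§2) — the `hblk` input of (W1) ✓`Prop7BlockConvolutionWeightedSup.norm_equiv_apply_le_of_blockLetter`, which turns it into the κ-weighted sup letter of `P` (and of
# `R_S = 1 − P` under Lift) for the (cκ)-package (★p1 g27 CHAIR WORD №30 (2); width seat `ym3-torus-px5` gen 14; replaces the source-form leg SRC-κ priced by px5 g13).

Cell `ym3-torus` (HUMAN RULING D-0037; rung R3 = SU(2) YM₃ on T³ — NOT d = 4, NOT infinite volume, NOT a mass gap, NOT Clay).  THEOREMS ONLY (0 `def`, 0 `sorry`, default heartbeats);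
`--supports stmt-QuantumFields-19200 --as helper`; count-neutral.

THE MATHEMATICS ([Balaban1985BackgroundPropagators] (3.49) p.399: the kernel of `R(U₀)` between fine sites decays in the coarse distance of their blocks with the factor `η³`).
Write `g = Σ_{x′} toL2S(δ_{x′} ⊗ g(x′))` (`Finset.univ_sum_single`); the spikes off `B(v)` vanish; the spike kernel letter `‖(P(toL2S(δ_{x′} ⊗ X′)))(x₀)‖ ≤ C_P·e^{−μ′·tdist(B x₀, B x′)}·‖X′‖_{W₂}`
and `‖g(x′)‖_{W₂} ≤ G_b` on the `(L^d)^{K−n}` sites of `B(v)` (✓`card_iterBlock`) give `C_P·(L^d)^{K−n}·G_b·e^{−μ′·tdist(B x₀, v)}`.  With V5b's `C_P = (c₀∕c₁)·C`, the product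
`(c₀∕c₁)·(L^d)^{K−n} = 1` at the pin `c₁ = c₀ℓ³` — print's `η³` against the block volume: K-FREE.

WHAT IS PROVED (ns `Summit.QuantumFields.YangMills.Theorems.Prop7ComplementaryProjectorBlockSup`; member `F`, `n ≤ K`, weight `c₀`).
* §1 ★★ `blockLetter_of_spikeKernel` — for ANY ℂ-linear `P` on the member site space with a displayed spike kernel letter `hker` (rate `μ′`, constant `C_P`): the ONE-BLOCK letter
  `g ⊂ B(v), ‖g(x)‖ ≤ G_b ⟹ ‖(Pg)(x₀)‖ ≤ C_P·(L^d)^{K−n}·G_b·e^{−μ′·tdist(B x₀, v)}` — exactly the `hblk` shape of (W1) §2.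
* §2 ★★★ **`blockLetter_sub_projR_closed`** — §1 at `P := 1 − projR Δ_{U₀} Q″` with `hker` DISCHARGED BY NAME by V5b (letters VERBATIM: `RegPr` + `10⁷L³ε₀ ≤ 1`, the LOD letters
  `hseq hι hT hAG hGA`, the column Agmon window at slope `μ` (`hδ₂w`, `hwin₂`), a Gram slope `0 ≤ μ′ < (min μ ¼)∕2` with B2c's window∕gap rows (`hδ`, `hwin`, `hgap`), `‖ι(Q″·)‖ ≤ C_T‖·‖`,
  `‖G‖ ≤ C_G`, the coarse coercivity `m_B‖f‖ ≤ ‖G(Tf)‖`): for `g ⊂ B(v)`, `‖g(x)‖ ≤ G_b`: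
  `‖((1 − projR Δ_{U₀} Q″) g)(x₀)‖ ≤ C_P^{V5b}·(L^d)^{K−n}·G_b·e^{−μ′·tdist(B x₀, v)}` (LinearMap form = (W1) §2's `hblk` at `A := 1 − projR Δ_{U₀} Q″` by `exact`);
  `blockLetter_sub_projR_closed'` — the same read as `g − projR Δ_{U₀} Q″ g`.
HYP-SAT (★★OWNER RULING №42 (1)): as V5b ✓p762771∕V4 ✓p762742 state — every hypothesis is inhabited on the literal T³ families (`hseq hι hT` ⟸ ✓`exists_intertwiner_of_regPr`;
`G hAG hGA` ⟸ ✓`exists_massive_inverse`; the windows at small `μ`, `μ′` and `hgap`∕`hcoer`∕`hCTb`∕`hGn` ⟸ routeR-w2's ✓`Prop7ComplementaryProjectorBlockDecayKnit` letters from `RegPr`,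
K-free at the pin); §1's `hker` is a real-inequality schema inhabited in §2 by name; conclusions non-vacuous.
HONEST SCOPE.  Summation over a landed kernel row; the VALUE letter of `P` only (no gradient of `P`); nothing of N6 FILE D, `norm_G`, the ten EX rows, EX or the crux is proved
here; the Yang–Mills mass gap is NOT proved.

References: T. Bałaban, CMP **99** (1985) 389–434 [Balaban1985BackgroundPropagators] ((3.21)–(3.25) p.394, Thm 3.1 (3.42) p.397, (3.46) p.398, (3.49) p.399);
CMP **116** (1988) 1–22 [Balaban1988RG2Cluster] ((2.7) p.13); CMP **95** (1984) 17–40 [Balaban1984PropagatorsI] ((1.18) p.20).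
-/

set_option autoImplicit false

noncomputable section

open scoped BigOperators Matrix.Norms.L2Operator InnerProductSpace ComplexConjugate Matrix

namespace Summit.QuantumFields.YangMills.Theorems.Prop7ComplementaryProjectorBlockSup

open Literature.MathematicalPhysics.QuantumFieldTheory.Balaban1983to89
open Finset
open T4Continuum BlockAveraging
open BlockAveraging (Idx)
open B7Prop1Explicit (U1 disp)
open B5Eq118OneStroke (iterBlockOf iterBlock mem_iterBlock card_iterBlock)
open B10Eq27TorusAxialLog (holT transl)
open B7TransferAnalyticMean (meanCLM)
open B4Sect5Torus (TSite)
open B9Eq311L2Pairing (WL2)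
open B11Eq103H1Complex (SiteL2K BondL2K projR)
open Summit.QuantumFields.YangMills.Theorems.Prop8Chart (emlIterU)
open Literature.MathematicalPhysics.QuantumFieldTheory.Balaban1983to89.T3ContinuumYM3Torus
open T3SectALandauChart (eta eta_pos bgUnits)
open T3PrintedRegularMinimiser (RegPr)
open T3PrintedRegularOrbits (sites_eq)
open T3LevelShift (siteShift)
open Summit.QuantumFields.YangMills.Theorems.Prop7SectET3Transport (periodsT3 siteEquiv)
open Summit.QuantumFields.YangMills.Theorems.Prop7SectET3HilbertLetters (W₂ frobEquiv toL2 toL2S DL2 DstarL2 covLapSite toL2S_apply toL2S_symm_apply)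
open Summit.QuantumFields.YangMills.Theorems.Prop7ComplementaryProjectorPointwiseDecayClosed (norm_equiv_sub_projR_single_le_closed)

variable (F : T3Family) {n K : ℕ} (h : n ≤ K) {c₀ c₁ : ℝ} [Fact (0 < c₀)] [Fact (0 < c₁)]
  {ε₀ : ℝ} (hε₀ : 0 < ε₀) (hε7 : 10 ^ 7 * (F.L : ℝ) ^ 3 * ε₀ ≤ 1)
  (U₀ : GaugeField (F.P K) 0 (Matrix.specialUnitaryGroup (Fin 2) ℂ)) (hreg : RegPr F n K ε₀ U₀)
  (Q'' : SiteL2K ℂ 3 (periodsT3 F K) c₀ W₂ →ₗ[ℂ] (Site (F.P K) (K - n) → Matrix (Fin 2) (Fin 2) ℂ))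
  (hseq : ∀ lam : Site (F.P K) 0 → Matrix (Fin 2) (Fin 2) ℂ, ∃ ns : (j : ℕ) → Site (F.P K) j → Matrix (Fin 2) (Fin 2) ℂ, ns 0 = lam ∧
      (∀ (j : ℕ) (y : Site (F.P K) (j + 1)), ns (j + 1) y = ns j (emb y) - meanCLM (Idx (F.P K)) (Matrix (Fin 2) (Fin 2) ℂ) fun i : Idx (F.P K) =>
        ns j (emb y) - ((holT (emlIterU j (bgUnits F K U₀)) (emb y) (stairWord i.2.1 (off i.1)) : (Matrix (Fin 2) (Fin 2) ℂ)ˣ) : Matrix (Fin 2) (Fin 2) ℂ) *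
          ns j (transl (emb y) (disp (stairWord i.2.1 (off i.1)))) * (((holT (emlIterU j (bgUnits F K U₀)) (emb y) (stairWord i.2.1 (off i.1)))⁻¹ : (Matrix (Fin 2) (Fin 2) ℂ)ˣ) : Matrix (Fin 2) (Fin 2) ℂ)) ∧
      ns (K - n) = Q'' (toL2S F K c₀ lam))
  (ι : (Site (F.P K) (K - n) → Matrix (Fin 2) (Fin 2) ℂ) →ₗ[ℂ] SiteL2K ℂ 3 (periodsT3 F n) c₁ W₂)
  (hι : ∀ c, ι c = toL2S F n c₁ (fun z => c (siteShift (sites_eq F n K h) z)))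
  (T : SiteL2K ℂ 3 (periodsT3 F n) c₁ W₂ →ₗ[ℂ] SiteL2K ℂ 3 (periodsT3 F K) c₀ W₂)
  (hT : ∀ (l : SiteL2K ℂ 3 (periodsT3 F K) c₀ W₂) (f : SiteL2K ℂ 3 (periodsT3 F n) c₁ W₂), ⟪ι (Q'' l), f⟫_ℂ = ⟪l, T f⟫_ℂ)
  {a : ℝ} (ha : 0 < a)
  (G : SiteL2K ℂ 3 (periodsT3 F K) c₀ W₂ →ₗ[ℂ] SiteL2K ℂ 3 (periodsT3 F K) c₀ W₂)
  (hAG : ∀ f, covLapSite F n K c₀ U₀ (G f) + (a : ℂ) • T (ι (Q'' (G f))) = f)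
  (hGA : ∀ u, G (covLapSite F n K c₀ U₀ u + (a : ℂ) • T (ι (Q'' u))) = u)

/-! ## §1 ★★ From a spike kernel letter to the one-block sup letter (any linear `P`) -/

omit [Fact (0 < c₀)] [Fact (0 < c₁)] in
/-- ★★ **ONE-BLOCK SUP LETTER FROM A SPIKE KERNEL LETTER.**  Let `P` be ℂ-linear on the member site space with the kernel letter
`‖(P(toL2S(δ_{x′} ⊗ X′)))(x)‖_{W₂} ≤ C_P·e^{−μ′·tdist(B x, B x′)}·‖X′‖_{W₂}`.  Then for every `g` supported in the block `B(v)` with `‖g(x)‖_{W₂} ≤ G_b` and every `x₀`: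
`‖(Pg)(x₀)‖_{W₂} ≤ C_P·(L^d)^{K−n}·G_b·e^{−μ′·tdist(B x₀, v)}` — spike decomposition (`Finset.univ_sum_single`), the letter per spike, `(L^d)^{K−n}` sites per block (✓`card_iterBlock`).
[cite: Balaban1985BackgroundPropagators, (3.49) p.399; Balaban1984PropagatorsI, (1.18) p.20] -/
theorem blockLetter_of_spikeKernel (P : SiteL2K ℂ 3 (periodsT3 F K) c₀ W₂ →ₗ[ℂ] SiteL2K ℂ 3 (periodsT3 F K) c₀ W₂) {CP μ' : ℝ}
    (hker : ∀ (x' : Site (F.P K) 0) (X' : Matrix (Fin 2) (Fin 2) ℂ) (x : Site (F.P K) 0),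
      ‖WL2.equiv ℂ _ W₂ (P (toL2S F K c₀ (Pi.single x' X'))) (siteEquiv F K x)‖
        ≤ CP * Real.exp (-(μ' * (Site.tdist (P := F.P K) (iterBlockOf (K - n) x) (iterBlockOf (K - n) x') : ℝ))) * ‖(frobEquiv.symm X' : W₂)‖)
    (hCP : 0 ≤ CP) :
    ∀ (g : SiteL2K ℂ 3 (periodsT3 F K) c₀ W₂) (v : Site (F.P K) (K - n)), (∀ x, iterBlockOf (K - n) x ≠ v → (toL2S F K c₀).symm g x = 0) →
      ∀ Gb : ℝ, (∀ x : Site (F.P K) 0, ‖WL2.equiv ℂ _ W₂ g (siteEquiv F K x)‖ ≤ Gb) →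
        ∀ x₀ : Site (F.P K) 0, ‖WL2.equiv ℂ _ W₂ (P g) (siteEquiv F K x₀)‖
          ≤ CP * ((((F.P K).L : ℝ) ^ (F.P K).d) ^ (K - n)) * Gb * Real.exp (-(μ' * (Site.tdist (P := F.P K) (iterBlockOf (K - n) x₀) v : ℝ))) := by
  intro g v hgv Gb hGb x₀
  classical
  have hGb0 : 0 ≤ Gb := (norm_nonneg _).trans (hGb x₀)
  -- the spike decomposition of `g`
  set gm : Site (F.P K) 0 → Matrix (Fin 2) (Fin 2) ℂ := (toL2S F K c₀).symm g with hgm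
  have hdec : g = ∑ x', toL2S F K c₀ (Pi.single x' (gm x')) := by
    rw [← map_sum, Finset.univ_sum_single, hgm, LinearEquiv.apply_symm_apply]
  have hPsum : WL2.equiv ℂ _ W₂ (P g) (siteEquiv F K x₀) = ∑ x', WL2.equiv ℂ _ W₂ (P (toL2S F K c₀ (Pi.single x' (gm x')))) (siteEquiv F K x₀) := by
    have e := congrFun (map_sum (WL2.linearEquiv ℂ ℂ (fun _ : TSite 3 (periodsT3 F K) => c₀) (V := W₂)) (fun x' => P (toL2S F K c₀ (Pi.single x' (gm x')))) Finset.univ)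
      (siteEquiv F K x₀)
    simp only [WL2.linearEquiv_apply, Finset.sum_apply] at e
    rw [← e, ← map_sum, ← hdec]
  -- the value of `g` at `x′` in the fibre norm
  have hval : ∀ x', ‖(frobEquiv.symm (gm x') : W₂)‖ = ‖WL2.equiv ℂ _ W₂ g (siteEquiv F K x')‖ := by
    intro x'
    rw [hgm, toL2S_symm_apply, LinearEquiv.symm_apply_apply]
  set E : ℝ := Real.exp (-(μ' * (Site.tdist (P := F.P K) (iterBlockOf (K - n) x₀) v : ℝ))) with hE
  -- termwise: the letter on the block, zero off it
  have hterm : ∀ x', ‖WL2.equiv ℂ _ W₂ (P (toL2S F K c₀ (Pi.single x' (gm x')))) (siteEquiv F K x₀)‖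
      ≤ if iterBlockOf (K - n) x' = v then CP * Gb * E else 0 := by
    intro x'
    by_cases hx' : iterBlockOf (K - n) x' = v
    · rw [if_pos hx']
      calc _ ≤ CP * Real.exp (-(μ' * (Site.tdist (P := F.P K) (iterBlockOf (K - n) x₀) (iterBlockOf (K - n) x') : ℝ))) * ‖(frobEquiv.symm (gm x') : W₂)‖ :=
            hker x' (gm x') x₀
        _ ≤ CP * E * Gb := by
            rw [hx', hval]
            exact mul_le_mul_of_nonneg_left (hGb x') (by positivity)
        _ = _ := by ring
    · rw [if_neg hx', hgv x' hx', Pi.single_zero, map_zero, map_zero, WL2.equiv_zero, Pi.zero_apply, norm_zero]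
  -- the fine sites of the block
  have hk : K - n ≤ (F.P K).m + (F.P K).K := by
    show K - n ≤ F.m + K
    omega
  have hcard : ((Finset.univ.filter fun x : Site (F.P K) 0 => iterBlockOf (K - n) x = v).card : ℝ) = (((F.P K).L : ℝ) ^ (F.P K).d) ^ (K - n) := by
    have : (Finset.univ.filter fun x : Site (F.P K) 0 => iterBlockOf (K - n) x = v) = iterBlock (K - n) v := by
      ext x; simp [mem_iterBlock]
    rw [this, card_iterBlock (K - n) hk v]
    push_cast
    ring
  calc ‖WL2.equiv ℂ _ W₂ (P g) (siteEquiv F K x₀)‖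
      = ‖∑ x', WL2.equiv ℂ _ W₂ (P (toL2S F K c₀ (Pi.single x' (gm x')))) (siteEquiv F K x₀)‖ := by rw [hPsum]
    _ ≤ ∑ x', ‖WL2.equiv ℂ _ W₂ (P (toL2S F K c₀ (Pi.single x' (gm x')))) (siteEquiv F K x₀)‖ := norm_sum_le _ _
    _ ≤ ∑ x' : Site (F.P K) 0, (if iterBlockOf (K - n) x' = v then CP * Gb * E else 0) := Finset.sum_le_sum fun x' _ => hterm x'
    _ = (((F.P K).L : ℝ) ^ (F.P K).d) ^ (K - n) * (CP * Gb * E) := by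
        rw [Finset.sum_ite, Finset.sum_const_zero, add_zero, Finset.sum_const, nsmul_eq_mul, hcard]
    _ = _ := by ring

/-! ## §2 ★★★ The one-block sup letter of `P = 1 − R_{Q″}(U₀)`, closed down to the member letters -/

include hε₀ hε7 hreg hseq hι hT ha hAG hGA in
/-- ★★★ **THE ONE-BLOCK SUP LETTER OF PRINT's `P = 1 − R_{Q″}(U₀)`** ([Balaban1985BackgroundPropagators] (3.49) value half, summed over one block).  For every printed-regular member
(`RegPr`, `10⁷L³ε₀ ≤ 1`), the LOD letters, the column Agmon window at slope `μ > 0` (`hδ₂w`, `hwin₂`), a Gram slope `0 ≤ μ′ < (min μ ¼)∕2` with B2c's window∕gap rows (`hδ`, `hwin`,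
`hgap`), `‖ι(Q″·)‖ ≤ C_T‖·‖`, `‖G‖ ≤ C_G` and the coarse coercivity `m_B‖f‖ ≤ ‖G(Tf)‖` — V5b's letters VERBATIM —, for every `g` supported in `B(v)` with `‖g(x)‖_{W₂} ≤ G_b` and every `x₀`:
`‖(g − projR Δ_{U₀} Q″ g)(x₀)‖_{W₂} ≤ C_P^{V5b}·(L^d)^{K−n}·G_b·e^{−μ′·tdist(B x₀, v)}` — §1 at `P := 1 − projR Δ_{U₀} Q″`, `hker` := ✓`norm_equiv_sub_projR_single_le_closed`.
`C_P^{V5b}` carries `c₀∕c₁`, so `C_P^{V5b}·(L^d)^{K−n}` is K-free at the pin `c₁ = c₀ℓ³`. [cite: Balaban1985BackgroundPropagators, (3.21)–(3.25) p.394, (3.49) p.399; Balaban1988RG2Cluster, (2.7) p.13] -/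
theorem blockLetter_sub_projR_closed
    {μ : ℝ} (hμ : 0 < μ) {δ₂ : ℝ} (hδ₂ : 0 ≤ δ₂)
    (hδ₂w : 3 * ((eta F n K)⁻¹) ^ 2 * (Real.exp (μ * eta F n K) - 1) ^ 2 + a * ((25 / 8) * (c₁ * ((((F.P K).L : ℝ) ^ (F.P K).d) ^ (K - n))⁻¹ / c₀)) * (Real.exp (3 * μ) - 1) ^ 2 ≤ δ₂ ^ 2)
    (hwin₂ : Real.sqrt (max 2 (16 * c₀ * ((F.L : ℝ) ^ (K - n)) ^ 3 / (a * c₁))) * δ₂ ≤ 1 / 10)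
    {μ' : ℝ} (hμ' : 0 ≤ μ') (hμ'κ : μ' < (min μ (1 / 4) / 2))
    {δ₁ : ℝ} (hδ₁ : 0 ≤ δ₁)
    (hδ : 3 * ((eta F n K)⁻¹) ^ 2 * (Real.exp (μ' * eta F n K) - 1) ^ 2 + a * ((25 / 8) * (c₁ * ((((F.P K).L : ℝ) ^ (F.P K).d) ^ (K - n))⁻¹ / c₀)) * (Real.exp (3 * μ') - 1) ^ 2 ≤ δ₁ ^ 2)
    (hwin : Real.sqrt (max 2 (16 * c₀ * ((F.L : ℝ) ^ (K - n)) ^ 3 / (a * c₁))) * δ₁ ≤ 1 / 10)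
    {CT : ℝ} (hCT : 0 ≤ CT) (hCTb : ∀ l : SiteL2K ℂ 3 (periodsT3 F K) c₀ W₂, ‖ι (Q'' l)‖ ≤ CT * ‖l‖)
    {CG : ℝ} (hCG : 0 ≤ CG) (hGn : ∀ f, ‖G f‖ ≤ CG * ‖f‖)
    {mB : ℝ} (hmB : 0 < mB) (hcoer : ∀ f : SiteL2K ℂ 3 (periodsT3 F n) c₁ W₂, mB * ‖f‖ ≤ ‖G (T f)‖)
    (hgap : 3 * ((Real.sqrt (max 2 (16 * c₀ * ((F.L : ℝ) ^ (K - n)) ^ 3 / (a * c₁))) * (2 + Real.sqrt (max 2 (16 * c₀ * ((F.L : ℝ) ^ (K - n)) ^ 3 / (a * c₁)))))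
          * (Real.sqrt 3 * (eta F n K)⁻¹ * (Real.exp (μ' * eta F n K) - 1) + (Real.sqrt 3 * (eta F n K)⁻¹ * (Real.exp (μ' * eta F n K) - 1)) ^ 2 + Real.sqrt a * CT * (Real.exp (3 * μ') - 1) + a * CT ^ 2 * (Real.exp (3 * μ') - 1) ^ 2)
          * (8 * Real.sqrt (max 2 (16 * c₀ * ((F.L : ℝ) ^ (K - n)) ^ 3 / (a * c₁))) + 8 * Real.sqrt (max 2 (16 * c₀ * ((F.L : ℝ) ^ (K - n)) ^ 3 / (a * c₁))) ^ 2)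
          * (CT * (1 + (Real.exp (3 * μ') - 1))) + CG * (CT * (Real.exp (3 * μ') - 1))) ^ 2 < mB ^ 2 / 2) :
    ∀ (g : SiteL2K ℂ 3 (periodsT3 F K) c₀ W₂) (v : Site (F.P K) (K - n)), (∀ x, iterBlockOf (K - n) x ≠ v → (toL2S F K c₀).symm g x = 0) →
      ∀ Gb : ℝ, (∀ x : Site (F.P K) 0, ‖WL2.equiv ℂ _ W₂ g (siteEquiv F K x)‖ ≤ Gb) →
        ∀ x₀ : Site (F.P K) 0, ‖WL2.equiv ℂ _ W₂ ((LinearMap.id - projR (covLapSite F n K c₀ U₀) Q'' : SiteL2K ℂ 3 (periodsT3 F K) c₀ W₂ →ₗ[ℂ] SiteL2K ℂ 3 (periodsT3 F K) c₀ W₂) g) (siteEquiv F K x₀)‖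
          ≤ ((c₀ / c₁) * ((14 * (8 * Real.exp (3 * min μ (1 / 4)) *
              ((5 / 4) * Real.sqrt (2 * c₁) * ((((F.P K).L : ℝ) ^ (F.P K).d) ^ (K - n))⁻¹ / c₀ * Real.sqrt (2 * c₁)
                + Real.exp (3 * μ) * ((a * ((5 / 4) * Real.sqrt (2 * c₁) * ((((F.P K).L : ℝ) ^ (F.P K).d) ^ (K - n))⁻¹ / c₀) *
                    Real.sqrt ((25 / 8) * (c₁ * ((((F.P K).L : ℝ) ^ (F.P K).d) ^ (K - n))⁻¹ / c₀))) *
                  ((8 * Real.sqrt (max 2 (16 * c₀ * ((F.L : ℝ) ^ (K - n)) ^ 3 / (a * c₁))) ^ 2) *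
                    (Real.sqrt ((25 / 8) * (c₁ * ((((F.P K).L : ℝ) ^ (F.P K).d) ^ (K - n))⁻¹ / c₀)) * Real.sqrt (2 * c₁)))))))
          + (Real.sqrt (3 ^ 3 / (c₀ * ((F.L : ℝ) ^ (K - n)) ^ 3) * 8) *
              (Real.sqrt (8 * Real.exp (3 * min μ (1 / 4)) * Real.exp (6 * μ) * (2 * (1 + 1 / μ)) ^ 3) *
              ((8 * Real.sqrt (max 2 (16 * c₀ * ((F.L : ℝ) ^ (K - n)) ^ 3 / (a * c₁))) ^ 2) *
                (Real.sqrt ((25 / 8) * (c₁ * ((((F.P K).L : ℝ) ^ (F.P K).d) ^ (K - n))⁻¹ / c₀)) * Real.sqrt (2 * c₁)))))) ^ 2 * ((mB ^ 2 / 2 - 3 * ((Real.sqrt (max 2 (16 * c₀ * ((F.L : ℝ) ^ (K - n)) ^ 3 / (a * c₁))) * (2 + Real.sqrt (max 2 (16 * c₀ * ((F.L : ℝ) ^ (K - n)) ^ 3 / (a * c₁)))))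
          * (Real.sqrt 3 * (eta F n K)⁻¹ * (Real.exp (μ' * eta F n K) - 1) + (Real.sqrt 3 * (eta F n K)⁻¹ * (Real.exp (μ' * eta F n K) - 1)) ^ 2 + Real.sqrt a * CT * (Real.exp (3 * μ') - 1) + a * CT ^ 2 * (Real.exp (3 * μ') - 1) ^ 2)
          * (8 * Real.sqrt (max 2 (16 * c₀ * ((F.L : ℝ) ^ (K - n)) ^ 3 / (a * c₁))) + 8 * Real.sqrt (max 2 (16 * c₀ * ((F.L : ℝ) ^ (K - n)) ^ 3 / (a * c₁))) ^ 2)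
          * (CT * (1 + (Real.exp (3 * μ') - 1))) + CG * (CT * (Real.exp (3 * μ') - 1))) ^ 2)⁻¹ * Real.exp (9 * μ'))
        * (4 * (2 * (1 + 1 / ((min μ (1 / 4) / 2) - μ'))) ^ 3) ^ 2)
          * ((((F.P K).L : ℝ) ^ (F.P K).d) ^ (K - n)) * Gb * Real.exp (-(μ' * (Site.tdist (P := F.P K) (iterBlockOf (K - n) x₀) v : ℝ))) := by
  intro g v hgv Gb hGb x₀
  have hc₀ : 0 < c₀ := Fact.out
  have hc₁ : 0 < c₁ := Fact.out
  have hN : 0 < mB ^ 2 / 2 - 3 * ((Real.sqrt (max 2 (16 * c₀ * ((F.L : ℝ) ^ (K - n)) ^ 3 / (a * c₁))) * (2 + Real.sqrt (max 2 (16 * c₀ * ((F.L : ℝ) ^ (K - n)) ^ 3 / (a * c₁)))))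
          * (Real.sqrt 3 * (eta F n K)⁻¹ * (Real.exp (μ' * eta F n K) - 1) + (Real.sqrt 3 * (eta F n K)⁻¹ * (Real.exp (μ' * eta F n K) - 1)) ^ 2 + Real.sqrt a * CT * (Real.exp (3 * μ') - 1) + a * CT ^ 2 * (Real.exp (3 * μ') - 1) ^ 2)
          * (8 * Real.sqrt (max 2 (16 * c₀ * ((F.L : ℝ) ^ (K - n)) ^ 3 / (a * c₁))) + 8 * Real.sqrt (max 2 (16 * c₀ * ((F.L : ℝ) ^ (K - n)) ^ 3 / (a * c₁))) ^ 2)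
          * (CT * (1 + (Real.exp (3 * μ') - 1))) + CG * (CT * (Real.exp (3 * μ') - 1))) ^ 2 := sub_pos.mpr hgap
  have hk := blockLetter_of_spikeKernel F (LinearMap.id - projR (covLapSite F n K c₀ U₀) Q'') (μ' := μ')
    (fun x' X' x => by
      rw [LinearMap.sub_apply, LinearMap.id_apply]
      exact norm_equiv_sub_projR_single_le_closed F h hε₀ hε7 U₀ hreg Q'' hseq ι hι T hT ha G hAG hGA hμ hδ₂ hδ₂w hwin₂ hμ' hμ'κ hδ₁ hδ hwin
        hCT hCTb hCG hGn hmB hcoer hgap x x' X')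
    (by positivity) g v hgv Gb hGb x₀
  exact hk

include hε₀ hε7 hreg hseq hι hT ha hAG hGA in
/-- ★★★ The same one-block sup letter of `P = 1 − R_{Q″}(U₀)` READ IN THE APPLIED FORM `g − projR Δ_{U₀} Q″ g` (`LinearMap.sub_apply`), for consumers who write the word out.
[cite: Balaban1985BackgroundPropagators, (3.21)–(3.25) p.394, (3.49) p.399] -/
theorem blockLetter_sub_projR_closed'
    {μ : ℝ} (hμ : 0 < μ) {δ₂ : ℝ} (hδ₂ : 0 ≤ δ₂)
    (hδ₂w : 3 * ((eta F n K)⁻¹) ^ 2 * (Real.exp (μ * eta F n K) - 1) ^ 2 + a * ((25 / 8) * (c₁ * ((((F.P K).L : ℝ) ^ (F.P K).d) ^ (K - n))⁻¹ / c₀)) * (Real.exp (3 * μ) - 1) ^ 2 ≤ δ₂ ^ 2)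
    (hwin₂ : Real.sqrt (max 2 (16 * c₀ * ((F.L : ℝ) ^ (K - n)) ^ 3 / (a * c₁))) * δ₂ ≤ 1 / 10)
    {μ' : ℝ} (hμ' : 0 ≤ μ') (hμ'κ : μ' < (min μ (1 / 4) / 2))
    {δ₁ : ℝ} (hδ₁ : 0 ≤ δ₁)
    (hδ : 3 * ((eta F n K)⁻¹) ^ 2 * (Real.exp (μ' * eta F n K) - 1) ^ 2 + a * ((25 / 8) * (c₁ * ((((F.P K).L : ℝ) ^ (F.P K).d) ^ (K - n))⁻¹ / c₀)) * (Real.exp (3 * μ') - 1) ^ 2 ≤ δ₁ ^ 2)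
    (hwin : Real.sqrt (max 2 (16 * c₀ * ((F.L : ℝ) ^ (K - n)) ^ 3 / (a * c₁))) * δ₁ ≤ 1 / 10)
    {CT : ℝ} (hCT : 0 ≤ CT) (hCTb : ∀ l : SiteL2K ℂ 3 (periodsT3 F K) c₀ W₂, ‖ι (Q'' l)‖ ≤ CT * ‖l‖)
    {CG : ℝ} (hCG : 0 ≤ CG) (hGn : ∀ f, ‖G f‖ ≤ CG * ‖f‖)
    {mB : ℝ} (hmB : 0 < mB) (hcoer : ∀ f : SiteL2K ℂ 3 (periodsT3 F n) c₁ W₂, mB * ‖f‖ ≤ ‖G (T f)‖)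
    (hgap : 3 * ((Real.sqrt (max 2 (16 * c₀ * ((F.L : ℝ) ^ (K - n)) ^ 3 / (a * c₁))) * (2 + Real.sqrt (max 2 (16 * c₀ * ((F.L : ℝ) ^ (K - n)) ^ 3 / (a * c₁)))))
          * (Real.sqrt 3 * (eta F n K)⁻¹ * (Real.exp (μ' * eta F n K) - 1) + (Real.sqrt 3 * (eta F n K)⁻¹ * (Real.exp (μ' * eta F n K) - 1)) ^ 2 + Real.sqrt a * CT * (Real.exp (3 * μ') - 1) + a * CT ^ 2 * (Real.exp (3 * μ') - 1) ^ 2)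
          * (8 * Real.sqrt (max 2 (16 * c₀ * ((F.L : ℝ) ^ (K - n)) ^ 3 / (a * c₁))) + 8 * Real.sqrt (max 2 (16 * c₀ * ((F.L : ℝ) ^ (K - n)) ^ 3 / (a * c₁))) ^ 2)
          * (CT * (1 + (Real.exp (3 * μ') - 1))) + CG * (CT * (Real.exp (3 * μ') - 1))) ^ 2 < mB ^ 2 / 2) :
    ∀ (g : SiteL2K ℂ 3 (periodsT3 F K) c₀ W₂) (v : Site (F.P K) (K - n)), (∀ x, iterBlockOf (K - n) x ≠ v → (toL2S F K c₀).symm g x = 0) →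
      ∀ Gb : ℝ, (∀ x : Site (F.P K) 0, ‖WL2.equiv ℂ _ W₂ g (siteEquiv F K x)‖ ≤ Gb) →
        ∀ x₀ : Site (F.P K) 0, ‖WL2.equiv ℂ _ W₂ (g - projR (covLapSite F n K c₀ U₀) Q'' g) (siteEquiv F K x₀)‖
          ≤ ((c₀ / c₁) * ((14 * (8 * Real.exp (3 * min μ (1 / 4)) *
              ((5 / 4) * Real.sqrt (2 * c₁) * ((((F.P K).L : ℝ) ^ (F.P K).d) ^ (K - n))⁻¹ / c₀ * Real.sqrt (2 * c₁)
                + Real.exp (3 * μ) * ((a * ((5 / 4) * Real.sqrt (2 * c₁) * ((((F.P K).L : ℝ) ^ (F.P K).d) ^ (K - n))⁻¹ / c₀) *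
                    Real.sqrt ((25 / 8) * (c₁ * ((((F.P K).L : ℝ) ^ (F.P K).d) ^ (K - n))⁻¹ / c₀))) *
                  ((8 * Real.sqrt (max 2 (16 * c₀ * ((F.L : ℝ) ^ (K - n)) ^ 3 / (a * c₁))) ^ 2) *
                    (Real.sqrt ((25 / 8) * (c₁ * ((((F.P K).L : ℝ) ^ (F.P K).d) ^ (K - n))⁻¹ / c₀)) * Real.sqrt (2 * c₁)))))))
          + (Real.sqrt (3 ^ 3 / (c₀ * ((F.L : ℝ) ^ (K - n)) ^ 3) * 8) *
              (Real.sqrt (8 * Real.exp (3 * min μ (1 / 4)) * Real.exp (6 * μ) * (2 * (1 + 1 / μ)) ^ 3) *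
              ((8 * Real.sqrt (max 2 (16 * c₀ * ((F.L : ℝ) ^ (K - n)) ^ 3 / (a * c₁))) ^ 2) *
                (Real.sqrt ((25 / 8) * (c₁ * ((((F.P K).L : ℝ) ^ (F.P K).d) ^ (K - n))⁻¹ / c₀)) * Real.sqrt (2 * c₁)))))) ^ 2 * ((mB ^ 2 / 2 - 3 * ((Real.sqrt (max 2 (16 * c₀ * ((F.L : ℝ) ^ (K - n)) ^ 3 / (a * c₁))) * (2 + Real.sqrt (max 2 (16 * c₀ * ((F.L : ℝ) ^ (K - n)) ^ 3 / (a * c₁)))))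
          * (Real.sqrt 3 * (eta F n K)⁻¹ * (Real.exp (μ' * eta F n K) - 1) + (Real.sqrt 3 * (eta F n K)⁻¹ * (Real.exp (μ' * eta F n K) - 1)) ^ 2 + Real.sqrt a * CT * (Real.exp (3 * μ') - 1) + a * CT ^ 2 * (Real.exp (3 * μ') - 1) ^ 2)
          * (8 * Real.sqrt (max 2 (16 * c₀ * ((F.L : ℝ) ^ (K - n)) ^ 3 / (a * c₁))) + 8 * Real.sqrt (max 2 (16 * c₀ * ((F.L : ℝ) ^ (K - n)) ^ 3 / (a * c₁))) ^ 2)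
          * (CT * (1 + (Real.exp (3 * μ') - 1))) + CG * (CT * (Real.exp (3 * μ') - 1))) ^ 2)⁻¹ * Real.exp (9 * μ'))
        * (4 * (2 * (1 + 1 / ((min μ (1 / 4) / 2) - μ'))) ^ 3) ^ 2)
          * ((((F.P K).L : ℝ) ^ (F.P K).d) ^ (K - n)) * Gb * Real.exp (-(μ' * (Site.tdist (P := F.P K) (iterBlockOf (K - n) x₀) v : ℝ))) := by
  intro g v hgv Gb hGb x₀
  have hk := blockLetter_sub_projR_closed F h hε₀ hε7 U₀ hreg Q'' hseq ι hι T hT ha G hAG hGA hμ hδ₂ hδ₂w hwin₂ hμ' hμ'κ hδ₁ hδ hwin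
    hCT hCTb hCG hGn hmB hcoer hgap g v hgv Gb hGb x₀
  rwa [LinearMap.sub_apply, LinearMap.id_apply] at hk

end Summit.QuantumFields.YangMills.Theorems.Prop7ComplementaryProjectorBlockSup

end
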